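import Summits.RiemannHypothesis.RiemannHypothesis.Theorems.SoloInformedCombBump
import Summits.RiemannHypothesis.RiemannHypothesis.Theorems.SoloInformedTimeLimitLeak
import Literature.NumberTheory.LFunctions.WeilDilationVirial
import HarnessLib

/-!
# T70a — scale-adapted window tests: exponential concentration below a chosen frequency

For every `n ≥ 1` there is a Weil test function `Φ` supported in `[-1, 1]` whose transform on the
critical line is exponentially concentrated below frequency `≍ n`:

  `|Φ̂(1/2 + it)|² ≤ (π / n) · (C₁ n / |t|)^{2n} · ‖Φ‖₂²`   (`t ≠ 0`, `C₁ ≥ 1` absolute)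

(`exists_scaleAdapted_test`), hence for every `R ≥ C` a test `Φ` on `[-1, 1]` with

  `(1 + t²) |Φ̂(1/2 + it)|² ≤ C (1 + R²) e^{-R/C} ‖Φ‖₂²`   for all `|t| ≥ R`

(`exists_test_exp_decay`).  This is the optimal SHAPE of leakage for time-limited functions
(compare the lower bound `L ≥ e^{-6aΩ} E` of T63, `weil_leak_ge_exp_neg`): a fixed bump gives only
polynomial tails `R^{-N}`, and reaching `e^{-cR}` requires adapting the test to the scale `R`.
Construction: `Φ = ψ ⋆ ⋯ ⋆ ψ` (`n` factors) with `ψ(x) = χ(nx)`, `χ = windowPlateau 1` the plateau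
bump of T14/T39b, so `supp Φ ⊆ [-1, 1]` and `Φ̂ = ψ̂ⁿ`; one integration by parts gives
`|ψ̂(1/2+it)| ≤ L₁/|t|`, positivity of `χ` gives `|ψ̂(1/2+it)| ≥ cos(1) (∫χ)/n` for `|t| ≤ n`, and
Plancherel turns the latter into `‖Φ‖₂² ≥ (n/π)(c₀/n)^{2n}`.  Use (s20): the far-zero input of
the comb-pocket theorem T70 (`SoloInformedCombPocket`).
-/

open Complex Set Filter MeasureTheory Literature.NumberTheory.LFunctions
open scoped Real Topology

namespace Summit.RiemannHypothesis.RiemannHypothesis.Theorems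

/-! ## Convolution powers -/

/-- Convolution powers of a test function: for every `m` there is a test function `Φ`
(`= φ ⋆ ⋯ ⋆ φ`, `m + 1` factors) with `Φ̂ = φ̂^{m+1}` and `supp Φ ⊆ [-(m+1)b, (m+1)b]`. -/
theorem exists_convolution_power {φ : ℝ → ℂ} (hφ : IsWeilTest φ) {b : ℝ}
    (hφb : tsupport φ ⊆ Icc (-b) b) :
    ∀ m : ℕ, ∃ Φ : ℝ → ℂ, IsWeilTest Φ ∧
      tsupport Φ ⊆ Icc (-(((m : ℝ) + 1) * b)) (((m : ℝ) + 1) * b) ∧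
      ∀ s : ℂ, weilMellin Φ s = weilMellin φ s ^ (m + 1)
  | 0 => ⟨φ, hφ, by simpa using hφb, fun s ↦ by rw [zero_add, pow_one]⟩
  | m + 1 => by
    obtain ⟨Φ, hΦ, hΦb, hΦs⟩ := exists_convolution_power hφ hφb m
    refine ⟨weilConv Φ φ, hΦ.weilConv hφ, ?_, fun s ↦ ?_⟩
    · refine (tsupport_weilConv_subset hΦ.2).trans ?_
      rintro x ⟨u, hu, v, hv, rfl⟩
      obtain ⟨hu1, hu2⟩ := hΦb hu
      obtain ⟨hv1, hv2⟩ := hφb hv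
      have e : (((m + 1 : ℕ) : ℝ) + 1) * b = ((m : ℝ) + 1) * b + b := by push_cast; ring
      rw [mem_Icc, e]
      constructor <;> linarith
    · rw [weilMellin_weilConv_holds hΦ.1.continuous hΦ.2 hφ.1.continuous hφ.2 s, hΦs]
      ring

/-! ## The plateau bump `χ = windowPlateau 1`: mass, size near the origin, decay -/

/-- `∫ χ > 0`. -/
theorem integral_windowPlateau_one_pos : 0 < ∫ x, windowPlateau 1 x :=
  (continuous_windowPlateau 1).integral_pos_of_hasCompactSupport_nonneg_nonzero
    (hasCompactSupport_windowPlateau 1) (fun x ↦ windowPlateau_nonneg 1 x)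
    (show windowPlateau 1 0 ≠ 0 by rw [windowPlateau_eq_one (by simp)]; exact one_ne_zero)

/-- `cos(1) χ(x) ≤ χ(x) cos(σx)` for `|σ| ≤ 1` (`supp χ ⊆ [-1, 1]`; `cos` decreases on `[0, π]`). -/
theorem cos_one_mul_windowPlateau_le {σ : ℝ} (hσ : |σ| ≤ 1) (x : ℝ) :
    Real.cos 1 * windowPlateau 1 x ≤ windowPlateau 1 x * Real.cos (σ * x) := by
  rcases le_or_gt 1 |x| with hx | hx
  · rw [windowPlateau_eq_zero hx]; simp
  · have h1 : |σ * x| ≤ 1 := by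
      rw [abs_mul]
      calc |σ| * |x| ≤ 1 * 1 := mul_le_mul hσ hx.le (abs_nonneg _) zero_le_one
        _ = 1 := one_mul 1
    have hcos : Real.cos 1 ≤ Real.cos (σ * x) := by
      rw [← Real.cos_abs (σ * x)]
      exact Real.cos_le_cos_of_nonneg_of_le_pi (abs_nonneg _)
        (by linarith [Real.pi_gt_three]) h1
    rw [mul_comm]
    exact mul_le_mul_of_nonneg_left hcos (windowPlateau_nonneg 1 x)

/-- Near the origin `χ̂` is large: `cos(1) ∫χ ≤ ‖χ̂(1/2 + iσ)‖` for `|σ| ≤ 1` (real part). -/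
theorem norm_weilMellin_combChi_ge {σ : ℝ} (hσ : |σ| ≤ 1) :
    Real.cos 1 * ∫ x, windowPlateau 1 x ≤ ‖weilMellin combChi (1 / 2 + σ * I)‖ := by
  have hcont : Continuous fun x : ℝ ↦ combChi x * cexp ((1 / 2 + σ * I - 1 / 2) * x) :=
    continuous_combChi.mul (by fun_prop)
  have hint : Integrable fun x : ℝ ↦ combChi x * cexp ((1 / 2 + σ * I - 1 / 2) * x) :=
    hcont.integrable_of_hasCompactSupport hasCompactSupport_combChi.mul_right
  have hre : ∀ x : ℝ, (combChi x * cexp ((1 / 2 + σ * I - 1 / 2) * x)).re =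
      windowPlateau 1 x * Real.cos (σ * x) := by
    intro x
    have e : (1 / 2 + (σ : ℂ) * I - 1 / 2) * (x : ℂ) = ((σ * x : ℝ) : ℂ) * I := by
      push_cast; ring
    rw [e, combChi, Complex.re_ofReal_mul, Complex.exp_ofReal_mul_I_re]
  have hi1 : Integrable fun x : ℝ ↦ Real.cos 1 * windowPlateau 1 x :=
    ((continuous_windowPlateau 1).integrable_of_hasCompactSupport
      (hasCompactSupport_windowPlateau 1)).const_mul _
  have hi2 : Integrable fun x : ℝ ↦ windowPlateau 1 x * Real.cos (σ * x) :=
    ((continuous_windowPlateau 1).mul (by fun_prop)).integrable_of_hasCompactSupport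
      (hasCompactSupport_windowPlateau 1).mul_right
  have hR := integral_re hint
  simp only [RCLike.re_to_complex, hre] at hR
  calc Real.cos 1 * ∫ x, windowPlateau 1 x = ∫ x, Real.cos 1 * windowPlateau 1 x :=
        (integral_const_mul _ _).symm
    _ ≤ ∫ x, windowPlateau 1 x * Real.cos (σ * x) :=
        integral_mono hi1 hi2 fun x ↦ cos_one_mul_windowPlateau_le hσ x
    _ = (weilMellin combChi (1 / 2 + σ * I)).re := by rw [hR]; rfl
    _ ≤ ‖weilMellin combChi (1 / 2 + σ * I)‖ := Complex.re_le_norm _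

/-- One integration by parts: `‖χ̂(1/2 + iσ)‖ · |σ| ≤ L₁ = weilL1 (χ')`. -/
theorem norm_weilMellin_combChi_mul_abs_le (σ : ℝ) :
    ‖weilMellin combChi (1 / 2 + σ * I)‖ * |σ| ≤ weilL1 (iteratedDeriv 1 combChi) := by
  have h0 : 0 ≤ (1 / 2 + (σ : ℂ) * I).re := by simp
  have h1 : (1 / 2 + (σ : ℂ) * I).re ≤ 1 := by simp; norm_num
  have h := Companion.norm_weilMellin_mul_pow_le isWeilTest_combChi 1 h0 h1
  rw [pow_one, add_sub_cancel_left, norm_mul, Complex.norm_I, mul_one, Complex.norm_real,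
    Real.norm_eq_abs] at h
  exact h

/-! ## The dilated bump `ψ(x) = χ(nx)` -/

/-- `‖ψ̂(1/2 + it)‖ = n⁻¹ ‖χ̂(1/2 + i t/n)‖` for `ψ(x) = χ(nx)`. -/
theorem norm_weilMellin_combChi_dilate {n : ℕ} (hn : 0 < n) (t : ℝ) :
    ‖weilMellin (fun x : ℝ ↦ combChi ((n : ℝ) * x)) (1 / 2 + t * I)‖ =
      (n : ℝ)⁻¹ * ‖weilMellin combChi (1 / 2 + (t / n : ℝ) * I)‖ := by
  have hn' : (0 : ℝ) < n := Nat.cast_pos.2 hn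
  rw [weilMellin_comp_mul combChi hn', norm_mul, norm_inv, Complex.norm_real,
    Real.norm_of_nonneg hn'.le]
  congr 3
  push_cast
  field_simp
  ring

/-! ## The scale-adapted test -/

/-- **Scale-adapted window tests.** There is an absolute `C₁ ≥ 1` such that for every `n ≥ 1`
some Weil test `Φ` with `supp Φ ⊆ [-1, 1]`, `‖Φ‖₂ > 0`, has
`|Φ̂(1/2 + it)|² ≤ (π/n) (C₁ n/|t|)^{2n} ‖Φ‖₂²` for all `t ≠ 0`. -/
theorem exists_scaleAdapted_test :
    ∃ C₁ : ℝ, 1 ≤ C₁ ∧ ∀ n : ℕ, 1 ≤ n → ∃ Φ : ℝ → ℂ, IsWeilTest Φ ∧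
      tsupport Φ ⊆ Icc (-1) 1 ∧ 0 < ∫ x, ‖Φ x‖ ^ 2 ∧
      ∀ t : ℝ, t ≠ 0 → ‖weilMellin Φ (1 / 2 + t * I)‖ ^ 2 ≤
        π / n * (C₁ * n / |t|) ^ (2 * n) * ∫ x, ‖Φ x‖ ^ 2 := by
  obtain ⟨c₀, hc₀⟩ : ∃ c₀ : ℝ, c₀ = Real.cos 1 * ∫ x, windowPlateau 1 x := ⟨_, rfl⟩
  obtain ⟨L₁, hL₁⟩ : ∃ L₁ : ℝ, L₁ = weilL1 (iteratedDeriv 1 combChi) := ⟨_, rfl⟩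
  have hcos : 0 < Real.cos 1 := Real.cos_pos_of_mem_Ioo
    ⟨by linarith [Real.pi_gt_three], by linarith [Real.pi_gt_three]⟩
  have hc₀pos : 0 < c₀ := hc₀ ▸ mul_pos hcos integral_windowPlateau_one_pos
  have hL₁0 : 0 ≤ L₁ := hL₁ ▸ weilL1_nonneg _
  refine ⟨max (L₁ / c₀) 1, le_max_right _ _, fun n hn ↦ ?_⟩
  have hn0 : 0 < n := hn
  have hnR : (0 : ℝ) < n := Nat.cast_pos.2 hn0
  -- the dilated bump `ψ`
  obtain ⟨ψ, hψ⟩ : ∃ ψ : ℝ → ℂ, ψ = fun x : ℝ ↦ combChi ((n : ℝ) * x) := ⟨_, rfl⟩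
  have hψt : IsWeilTest ψ := hψ ▸ isWeilTest_combChi.comp_mul hnR.ne'
  have hψs : tsupport ψ ⊆ Icc (-((n : ℝ)⁻¹)) ((n : ℝ)⁻¹) := by
    have h := tsupport_comp_mul_subset combChi hnR tsupport_combChi_subset
    rw [hψ, ← one_div]
    exact h
  have hm : ∀ t : ℝ, ‖weilMellin ψ (1 / 2 + t * I)‖ =
      (n : ℝ)⁻¹ * ‖weilMellin combChi (1 / 2 + (t / n : ℝ) * I)‖ := fun t ↦ by
    rw [hψ]; exact norm_weilMellin_combChi_dilate hn0 t
  have hlow : ∀ t : ℝ, |t| ≤ n → c₀ / n ≤ ‖weilMellin ψ (1 / 2 + t * I)‖ := by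
    intro t ht
    rw [hm, div_eq_inv_mul]
    refine mul_le_mul_of_nonneg_left ?_ (inv_nonneg.2 hnR.le)
    rw [hc₀]
    refine norm_weilMellin_combChi_ge ?_
    rw [abs_div, abs_of_pos hnR, div_le_one hnR]
    exact ht
  have hdec : ∀ t : ℝ, t ≠ 0 → ‖weilMellin ψ (1 / 2 + t * I)‖ ≤ L₁ / |t| := by
    intro t ht
    have htpos : 0 < |t| := abs_pos.2 ht
    rw [hm, le_div_iff₀ htpos]
    have h := norm_weilMellin_combChi_mul_abs_le (t / n)
    rw [← hL₁, abs_div, abs_of_pos hnR] at h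
    calc (n : ℝ)⁻¹ * ‖weilMellin combChi (1 / 2 + (t / n : ℝ) * I)‖ * |t|
        = ‖weilMellin combChi (1 / 2 + (t / n : ℝ) * I)‖ * (|t| / n) := by
          rw [div_eq_mul_inv]; ring
      _ ≤ L₁ := h
  -- the convolution power `Φ = ψ^{⋆ n}`
  obtain ⟨Φ, hΦ, hΦs, hΦm⟩ := exists_convolution_power hψt hψs (n - 1)
  have hn1 : ((n - 1 : ℕ) : ℝ) + 1 = n := by rw [Nat.cast_sub hn]; push_cast; ring
  have hpow : n - 1 + 1 = n := Nat.sub_add_cancel hn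
  rw [hn1, mul_inv_cancel₀ hnR.ne'] at hΦs
  simp only [hpow] at hΦm
  have hnorm : ∀ t : ℝ, ‖weilMellin Φ (1 / 2 + t * I)‖ = ‖weilMellin ψ (1 / 2 + t * I)‖ ^ n :=
    fun t ↦ by rw [hΦm, norm_pow]
  -- Plancherel: `2π ‖Φ‖₂² = ∫ |Φ̂|² ≥ 2n (c₀/n)^{2n}`
  have hP := integral_norm_sq_weilMellin_half_line hΦ
  have hfi := integrable_norm_sq_weilMellin_half_line hΦ
  have hbelow : 2 * n * (c₀ / n) ^ (2 * n) ≤ ∫ t : ℝ, ‖weilMellin Φ (1 / 2 + t * I)‖ ^ 2 := by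
    have hconst : ∫ _ in Icc (-(n : ℝ)) n, (c₀ / n) ^ (2 * n) = 2 * n * (c₀ / n) ^ (2 * n) := by
      rw [setIntegral_const, Real.volume_real_Icc_of_le (by linarith), smul_eq_mul]
      ring
    rw [← hconst]
    calc ∫ _ in Icc (-(n : ℝ)) n, (c₀ / n) ^ (2 * n)
        ≤ ∫ t in Icc (-(n : ℝ)) n, ‖weilMellin Φ (1 / 2 + t * I)‖ ^ 2 := by
          refine setIntegral_mono_on (integrableOn_const (by simp [Real.volume_Icc]))
            hfi.integrableOn measurableSet_Icc fun t ht ↦ ?_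
          rw [hnorm, ← pow_mul, mul_comm n 2]
          exact pow_le_pow_left₀ (by positivity) (hlow t (abs_le.2 ⟨ht.1, ht.2⟩)) _
      _ ≤ ∫ t : ℝ, ‖weilMellin Φ (1 / 2 + t * I)‖ ^ 2 :=
          setIntegral_le_integral hfi (Eventually.of_forall fun t ↦ by positivity)
  have hE : (n / π) * (c₀ / n) ^ (2 * n) ≤ ∫ x, ‖Φ x‖ ^ 2 := by
    have h2 : 2 * n * (c₀ / n) ^ (2 * n) ≤ 2 * π * ∫ x, ‖Φ x‖ ^ 2 := by
      rw [hP] at hbelow; exact hbelow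
    rw [div_mul_eq_mul_div, div_le_iff₀ Real.pi_pos]
    linarith
  have hEpos : 0 < ∫ x, ‖Φ x‖ ^ 2 := lt_of_lt_of_le (by positivity) hE
  refine ⟨Φ, hΦ, hΦs, hEpos, fun t ht ↦ ?_⟩
  have htpos : 0 < |t| := abs_pos.2 ht
  obtain ⟨C₁, hC₁⟩ : ∃ C₁ : ℝ, C₁ = max (L₁ / c₀) 1 := ⟨_, rfl⟩
  rw [← hC₁]
  have hC₁c₀ : L₁ ≤ C₁ * c₀ :=
    calc L₁ = L₁ / c₀ * c₀ := (div_mul_cancel₀ L₁ hc₀pos.ne').symm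
      _ ≤ C₁ * c₀ := mul_le_mul_of_nonneg_right (hC₁ ▸ le_max_left _ _) hc₀pos.le
  have hC₁0 : 0 ≤ C₁ := hC₁ ▸ zero_le_one.trans (le_max_right _ _)
  calc ‖weilMellin Φ (1 / 2 + t * I)‖ ^ 2 = ‖weilMellin ψ (1 / 2 + t * I)‖ ^ (2 * n) := by
        rw [hnorm, ← pow_mul, mul_comm n 2]
    _ ≤ (L₁ / |t|) ^ (2 * n) := pow_le_pow_left₀ (norm_nonneg _) (hdec t ht) _
    _ ≤ (C₁ * c₀ / |t|) ^ (2 * n) :=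
        pow_le_pow_left₀ (by positivity) (div_le_div_of_nonneg_right hC₁c₀ htpos.le) _
    _ = (C₁ * n / |t|) ^ (2 * n) * (c₀ / n) ^ (2 * n) := by
        rw [← mul_pow]; congr 1; field_simp
    _ = π / n * (C₁ * n / |t|) ^ (2 * n) * ((n / π) * (c₀ / n) ^ (2 * n)) := by
        field_simp
    _ ≤ π / n * (C₁ * n / |t|) ^ (2 * n) * ∫ x, ‖Φ x‖ ^ 2 :=
        mul_le_mul_of_nonneg_left hE (by positivity)

/-! ## Exponential form -/

/-- Monotonicity of the Cauchy-weighted tail: `(1 + t²) R^{2n} ≤ (1 + R²) |t|^{2n}` for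
`0 ≤ R ≤ |t|`, `n ≥ 1`. -/
theorem one_add_sq_mul_pow_le {R t : ℝ} (hR : 0 ≤ R) (hRt : R ≤ |t|) {n : ℕ} (hn : 1 ≤ n) :
    (1 + t ^ 2) * R ^ (2 * n) ≤ (1 + R ^ 2) * |t| ^ (2 * n) := by
  obtain ⟨k, rfl⟩ : ∃ k : ℕ, n = k + 1 := ⟨n - 1, (Nat.sub_add_cancel hn).symm⟩
  have h1 : R ^ (2 * (k + 1)) ≤ |t| ^ (2 * (k + 1)) := pow_le_pow_left₀ hR hRt _
  have h2 : R ^ (2 * k) ≤ |t| ^ (2 * k) := pow_le_pow_left₀ hR hRt _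
  calc (1 + t ^ 2) * R ^ (2 * (k + 1)) = R ^ (2 * (k + 1)) + t ^ 2 * R ^ 2 * R ^ (2 * k) := by
        ring
    _ ≤ |t| ^ (2 * (k + 1)) + t ^ 2 * R ^ 2 * |t| ^ (2 * k) :=
        add_le_add h1 (mul_le_mul_of_nonneg_left h2 (by positivity))
    _ = (1 + R ^ 2) * |t| ^ (2 * (k + 1)) := by rw [← sq_abs t]; ring

/-- **Exponential leakage shape.** There is an absolute `C > 0` such that for every `R ≥ C` some
Weil test `Φ` with `supp Φ ⊆ [-1, 1]`, `‖Φ‖₂ > 0`, has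
`(1 + t²) |Φ̂(1/2 + it)|² ≤ C (1 + R²) e^{-R/C} ‖Φ‖₂²` for all `|t| ≥ R`. -/
theorem exists_test_exp_decay :
    ∃ C : ℝ, 0 < C ∧ ∀ R : ℝ, C ≤ R → ∃ Φ : ℝ → ℂ, IsWeilTest Φ ∧
      tsupport Φ ⊆ Icc (-1) 1 ∧ 0 < ∫ x, ‖Φ x‖ ^ 2 ∧ ∀ t : ℝ, R ≤ |t| →
        (1 + t ^ 2) * ‖weilMellin Φ (1 / 2 + t * I)‖ ^ 2 ≤
          C * (1 + R ^ 2) * Real.exp (-(R / C)) * ∫ x, ‖Φ x‖ ^ 2 := by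
  obtain ⟨C₁, hC₁, hmain⟩ := exists_scaleAdapted_test
  obtain ⟨e, he⟩ : ∃ e : ℝ, e = Real.exp 1 := ⟨_, rfl⟩
  have he1 : 1 ≤ e := by rw [he]; linarith [Real.add_one_le_exp (1 : ℝ)]
  obtain ⟨C, hC⟩ : ∃ C : ℝ, C = e * C₁ + π * Real.exp 2 := ⟨_, rfl⟩
  have hπe : 0 < π * Real.exp 2 := by positivity
  have heC₁ : 1 ≤ e * C₁ := by nlinarith
  have hCge : e * C₁ ≤ C := by rw [hC]; linarith
  have hCpos : 0 < C := by linarith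
  refine ⟨C, hCpos, fun R hR ↦ ?_⟩
  have hRpos : 0 < R := by linarith
  have heC₁pos : 0 < e * C₁ := by linarith
  -- `n = ⌊R/(e C₁)⌋ ≥ 1`
  obtain ⟨n, hn⟩ : ∃ n : ℕ, n = ⌊R / (e * C₁)⌋₊ := ⟨_, rfl⟩
  have hq : 1 ≤ R / (e * C₁) := by rw [le_div_iff₀ heC₁pos]; linarith
  have hn0 : 0 < n := by rw [hn]; exact Nat.floor_pos.2 hq
  have hnle : (n : ℝ) ≤ R / (e * C₁) := by rw [hn]; exact Nat.floor_le (by positivity)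
  have hnlt : R / (e * C₁) < n + 1 := by rw [hn]; exact Nat.lt_floor_add_one _
  have hnR : (0 : ℝ) < n := Nat.cast_pos.2 hn0
  obtain ⟨Φ, hΦ, hΦs, hE, hdec⟩ := hmain n hn0
  refine ⟨Φ, hΦ, hΦs, hE, fun t ht ↦ ?_⟩
  have htpos : 0 < |t| := lt_of_lt_of_le hRpos ht
  have ht0 : t ≠ 0 := abs_pos.1 htpos
  -- (a) move the Cauchy weight to the threshold `R`
  have hA : (1 + t ^ 2) * (C₁ * n / |t|) ^ (2 * n) ≤ (1 + R ^ 2) * (C₁ * n / R) ^ (2 * n) := by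
    rw [div_pow, div_pow, mul_div_assoc', mul_div_assoc',
      div_le_div_iff₀ (pow_pos htpos _) (pow_pos hRpos _)]
    calc (1 + t ^ 2) * (C₁ * n) ^ (2 * n) * R ^ (2 * n)
        = (C₁ * n) ^ (2 * n) * ((1 + t ^ 2) * R ^ (2 * n)) := by ring
      _ ≤ (C₁ * n) ^ (2 * n) * ((1 + R ^ 2) * |t| ^ (2 * n)) :=
          mul_le_mul_of_nonneg_left (one_add_sq_mul_pow_le hRpos.le ht hn0) (by positivity)
      _ = (1 + R ^ 2) * (C₁ * n) ^ (2 * n) * |t| ^ (2 * n) := by ring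
  -- (b) `(C₁ n / R)^{2n} ≤ e^{-2n} ≤ e² e^{-R/C}`
  have hbase : C₁ * n / R ≤ Real.exp (-1) := by
    rw [div_le_iff₀ hRpos, Real.exp_neg, ← he]
    rw [le_div_iff₀ heC₁pos] at hnle
    have hee : e⁻¹ * e = 1 := inv_mul_cancel₀ (by linarith)
    nlinarith [hee, hnle]
  have hB : (C₁ * n / R) ^ (2 * n) ≤ Real.exp 2 * Real.exp (-(R / C)) := by
    have h1 : (C₁ * n / R) ^ (2 * n) ≤ Real.exp (-1) ^ (2 * n) :=
      pow_le_pow_left₀ (by positivity) hbase _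
    have h2 : Real.exp (-1) ^ (2 * n) = Real.exp (-(2 * n)) := by
      rw [← Real.exp_nat_mul]; congr 1; push_cast; ring
    have h3 : R / C ≤ R / (e * C₁) := div_le_div_of_nonneg_left hRpos.le heC₁pos hCge
    have h4 : -(2 * (n : ℝ)) ≤ 2 + -(R / C) := by linarith
    rw [← Real.exp_add]
    exact h1.trans (h2.le.trans (Real.exp_le_exp.2 h4))
  -- (c) assemble
  have hπn : π / n ≤ π := div_le_self Real.pi_pos.le (by exact_mod_cast hn0)
  have hE0 := hE.le
  calc (1 + t ^ 2) * ‖weilMellin Φ (1 / 2 + t * I)‖ ^ 2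
      ≤ (1 + t ^ 2) * (π / n * (C₁ * n / |t|) ^ (2 * n) * ∫ x, ‖Φ x‖ ^ 2) :=
        mul_le_mul_of_nonneg_left (hdec t ht0) (by positivity)
    _ = π / n * ((1 + t ^ 2) * (C₁ * n / |t|) ^ (2 * n)) * ∫ x, ‖Φ x‖ ^ 2 := by ring
    _ ≤ π * ((1 + R ^ 2) * (Real.exp 2 * Real.exp (-(R / C)))) * ∫ x, ‖Φ x‖ ^ 2 := by
        refine mul_le_mul_of_nonneg_right ?_ hE0
        refine mul_le_mul hπn (hA.trans ?_) (by positivity) Real.pi_pos.le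
        exact mul_le_mul_of_nonneg_left hB (by positivity)
    _ = π * Real.exp 2 * (1 + R ^ 2) * Real.exp (-(R / C)) * ∫ x, ‖Φ x‖ ^ 2 := by ring
    _ ≤ C * (1 + R ^ 2) * Real.exp (-(R / C)) * ∫ x, ‖Φ x‖ ^ 2 := by
        have hπC : π * Real.exp 2 ≤ C := by rw [hC]; linarith
        have h0 : 0 ≤ (1 + R ^ 2) * Real.exp (-(R / C)) * ∫ x, ‖Φ x‖ ^ 2 := by positivity
        nlinarith

end Summit.RiemannHypothesis.RiemannHypothesis.Theorems
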